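import Mathlib
import Summits.Ventures.HodgeRepro2.Tier7.Line3.ArchimedeanCover
import Summits.Ventures.HodgeRepro2.Tier7.Line3.ArchimedeanLattice

/-!
# Tier 7 — LINE 3 support: DESCENT OF THE TEST FUNCTION THROUGH THE NAMED COVER — a kernel-invariant function on
`(U(2) × U(1)²) × SL(2,ℝ)²` descends to a continuous function on `U(2) × U(1,1)²`, and the archimedean consumer reads
its per-place data (`Line3/ArchimedeanDescent.lean`; t7-L1-p1, gen 6; Mathlib + Line3/ArchimedeanCover + Line3/ArchimedeanLattice)

The consumers of this lineage (`ArchimedeanCover.continuous_kernelSum_H₃`, `ArchimedeanLattice.continuous_kernelSum_latticeIn`)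
take the test function `f : H₃ → ℂ` on the real archimedean group `H₃ = U(2) × U(1,1)²` with THREE binders: `f` continuous,
its pull-back `f ∘ cover` FACTORED as `f₁ ⊗ f₂ ⊗ f₃`, and the decay of `f₂, f₃`. The real test function is GIVEN per place on
the COVER `K₃ × G₂ = (U(2) × U(1)²) × SL(2,ℝ)²` (a function on `U(2)`, central characters on the two `U(1)`'s, Bergman-type
coefficients on the two `SL(2,ℝ)`'s) and lives on `H₃` only because it is invariant under the kernel of the cover (the parity
condition at `ι₂, ι₃`, in words). THIS FILE makes the descent a theorem of the cover:
* §1 `descend F : H₃ → ℂ` for `F : K₃ × G₂ → ℂ` := `F` composed with a set-theoretic section of `cover`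
  (`Function.surjInv surjective_cover`); for `F` KERNEL-INVARIANT (`hinv : ∀ g z, z ∈ cover.ker → F (g * z) = F g`,
  DISPLAYED — stated for the LITERAL `cover.ker`; no description of the kernel's elements is claimed in this file, and
  `hinv` is consumed in `descend_cover` and nowhere else) **`descend_cover : descend F (cover g) = F g`** (the section of
  `cover g` differs from `g` by a kernel element; the kernel is `finite_ker_cover`'s set, `{1} × {±(1, 1)} × {±(1, 1)}`
  by ArchimedeanCover §2–§3, and the real datum behind `hinv` is the parity condition `ω_v(−1) · b_v(−1) = 1` at `ι₂, ι₃`),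
  `descend_unique` (any `f′` with `f′ (cover g) = F g` for all `g` — the pointwise form — is `descend F`), `descend_const`
  (the constant `1` descends to `1`: not vacuous), and **`continuous_descend`**: `F` continuous ⇒ `descend F`
  continuous — the cover is a QUOTIENT map (`IsOpenMap.isQuotientMap` from ArchimedeanCover's `isOpenMap_cover`,
  `continuous_cover`, `surjective_cover`), so continuity descends;
* §2 THE CONSUMER **`continuous_kernelSum_descend`** = ArchimedeanLattice's `continuous_kernelSum_latticeIn` at
  `f := descend F` for `F g = f₁ g.1 * (f₂ g.2.1 * f₃ g.2.2)`, with `hfc := continuous_descend` and `hfp := descend_cover`: the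
  Poincaré series of `latticeIn E Γ e` for `descend F` is continuous on `H₃ × H₃`. REMAINING BINDERS: `htc`, `Γ`, `P`, `hΓ`,
  the labelling `e`, the per-place data `f₁` (continuous on `K₃`), `f₂ f₃` (continuous on `SL(2, ℝ)` with the
  `(1 + κ)^(−α)` decay, `α > 1`), and the kernel invariance `hinv` of the PRODUCT `f₁ ⊗ f₂ ⊗ f₃` — ONE binder, coupling the
  value of `f₁` under the scalars `−1` of the two `U(1)`'s with the values of `f₂`, `f₃` under `−1 ∈ SL(2, ℝ)` (the parity
  condition), NOT a consequence of properties of the three factors taken separately — every one a DATUM sentence about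
  the data on the COVER; nothing on `H₃` itself is displayed any more.

WHAT STAYS IN WORDS (the dictionary, (a′)): which `f₁` (the `ι₁`-function times the two central characters), which
`f₂ = f₃` (the Bergman / two-vector coefficient transported by `cay` — BergmanPoincare's `norm_bergmanCoeff`, L1-p5's
KappaDecay give the decay for those), that the parity condition holds for the real characters and weights (the `hinv`
datum: `ω_v(−1) · b_v(−1) = 1` at `ι₂, ι₃`), and the identifications of the previous rows (the cover, the labelling, the
lattice). Not vacuous: `F = 1` is invariant and descends to `1`; `F = f₁ ∘ Prod.fst` with `f₁` a function of the `U(2)`-factor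
only is invariant (the kernel lies in `{1} × (U(1)² × SL(2,ℝ)²)`). Nothing about (N), (P), the real X or HC_CM; [M]-level
consolidation of the [W] column; NOT distance to (P); the residual (a′)/(b′) is unchanged in kind; LEMMAS CLOSING THE STEP: 0.
Sorry-free; axioms: propext / Classical.choice / Quot.sound. §8(d): uses an L-value-free non-vanishing device: NO.
-/

namespace Summit.Ventures.HodgeRepro2.Tier7.Line3.ArchimedeanDescent

open NumberField Topology
open Summit.Ventures.HodgeRepro2.Tier7.Line3.ArchimedeanCover
  (H₃ cover continuous_cover surjective_cover isOpenMap_cover)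
open Summit.Ventures.HodgeRepro2.Tier7.Line3.ArchimedeanLattice (latticeIn continuous_kernelSum_latticeIn)
open Summit.Ventures.HodgeRepro2.Tier7.Line3.ArchimedeanDiscrete (IntegralEntries)
open Summit.Ventures.HodgeRepro2.Tier7.Line3.DiscreteUnitaryFactor (K₃)
open Summit.Ventures.HodgeRepro2.Tier7.Line3.DiscreteProductCount (G₂)
open Summit.Ventures.HodgeRepro2.Tier7.Line3.HyperbolicSize (κ)
open Summit.Ventures.HodgeRepro2.Tier7.Line3.PoincareKernel (kernelSum)
open scoped MatrixGroups

noncomputable section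

/-! ## 1. Descent through the cover -/

/-- a set-theoretic section of the cover: `cover (section h) = h` -/
def coverSection : H₃ → K₃ × G₂ := Function.surjInv surjective_cover

/-- `cover (coverSection h) = h` -/
theorem cover_coverSection (h : H₃) : cover (coverSection h) = h := Function.surjInv_eq surjective_cover h

/-- **the descent** of `F : K₃ × G₂ → ℂ` to `H₃`: `F` composed with the section -/
def descend (F : K₃ × G₂ → ℂ) : H₃ → ℂ := fun h => F (coverSection h)

/-- the section of `cover g` differs from `g` by an element of the kernel -/
theorem exists_mem_ker_coverSection (g : K₃ × G₂) : ∃ z ∈ cover.ker, coverSection (cover g) = g * z := by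
  refine ⟨g⁻¹ * coverSection (cover g), ?_, by group⟩
  rw [MonoidHom.mem_ker, map_mul, map_inv, cover_coverSection, inv_mul_cancel]

/-- **the pull-back of the descended function is the given one** (for `F` invariant under the kernel of the cover) -/
theorem descend_cover (F : K₃ × G₂ → ℂ) (hinv : ∀ g z, z ∈ cover.ker → F (g * z) = F g) (g : K₃ × G₂) :
    descend F (cover g) = F g := by
  obtain ⟨z, hz, hsec⟩ := exists_mem_ker_coverSection g
  show F (coverSection (cover g)) = F g
  rw [hsec]
  exact hinv g z hz

/-- the descended function is the unique function on `H₃` whose pull-back is `F` -/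
theorem descend_unique (F : K₃ × G₂ → ℂ) (hinv : ∀ g z, z ∈ cover.ker → F (g * z) = F g) (f' : H₃ → ℂ)
    (hf' : ∀ g, f' (cover g) = F g) : f' = descend F := by
  funext h
  obtain ⟨g, rfl⟩ := surjective_cover h
  rw [hf', descend_cover F hinv]

/-- the constant function `1` is kernel-invariant and descends to `1` (non-vacuity of the descent) -/
theorem descend_const (c : ℂ) : descend (fun _ => c) = fun _ => c := rfl

/-- the cover is a quotient map (open, continuous, surjective) -/
theorem isQuotientMap_cover : IsQuotientMap cover :=
  isOpenMap_cover.isQuotientMap continuous_cover surjective_cover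

/-- **continuity descends**: `F` continuous and kernel-invariant ⇒ `descend F` continuous (the cover is a quotient map) -/
theorem continuous_descend (F : K₃ × G₂ → ℂ) (hinv : ∀ g z, z ∈ cover.ker → F (g * z) = F g)
    (hF : Continuous F) : Continuous (descend F) := by
  rw [isQuotientMap_cover.continuous_iff]
  have h : (descend F ∘ cover) = F := funext fun g => descend_cover F hinv g
  rw [h]
  exact hF

/-- the product test function on the cover: `F g = f₁ g.1 * (f₂ g.2.1 * f₃ g.2.2)` -/
def productFn (f₁ : K₃ → ℂ) (f₂ f₃ : SL(2, ℝ) → ℂ) : K₃ × G₂ → ℂ :=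
  fun g => f₁ g.1 * (f₂ g.2.1 * f₃ g.2.2)

/-- the product test function is continuous when its factors are -/
theorem continuous_productFn {f₁ : K₃ → ℂ} {f₂ f₃ : SL(2, ℝ) → ℂ} (hc₁ : Continuous f₁) (hc₂ : Continuous f₂)
    (hc₃ : Continuous f₃) : Continuous (productFn f₁ f₂ f₃) :=
  (hc₁.comp continuous_fst).mul
    ((hc₂.comp (continuous_fst.comp continuous_snd)).mul (hc₃.comp (continuous_snd.comp continuous_snd)))

/-! ## 2. THE CONSUMER on the per-place data -/

/-- **THE ARCHIMEDEAN KERNEL IS CONTINUOUS FOR THE DESCENDED TEST FUNCTION**: ArchimedeanLattice's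
`continuous_kernelSum_latticeIn` at `f := descend (productFn f₁ f₂ f₃)` with `hfc := continuous_descend` and
`hfp := descend_cover`. Remaining binders: `htc`, `Γ`, `P`, `hΓ`, the labelling `e`, the per-place data `f₁ f₂ f₃` with
their continuity and decay, and the kernel invariance `hinv` — every one a datum sentence about the data on the cover. -/
theorem continuous_kernelSum_descend (E : Type) [Field E] [NumberField E]
    (htc : ∀ w : InfinitePlace E, w.IsComplex) (Γ : Subgroup (GL (Fin 2) E)) (P : GL (Fin 2) E)
    (hΓ : ∀ g ∈ Γ, IntegralEntries E ((P⁻¹ * g * P : GL (Fin 2) E) : Matrix (Fin 2) (Fin 2) E))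
    (e : Fin 3 ≃ {w : InfinitePlace E // w.IsComplex}) {f₁ : K₃ → ℂ} {f₂ f₃ : SL(2, ℝ) → ℂ}
    (hc₁ : Continuous f₁) (hc₂ : Continuous f₂) (hc₃ : Continuous f₃)
    (hinv : ∀ g z, z ∈ cover.ker → productFn f₁ f₂ f₃ (g * z) = productFn f₁ f₂ f₃ g) {C₂ C₃ α : ℝ} (hα : 1 < α)
    (h₂ : ∀ g, ‖f₂ g‖ ≤ C₂ * (1 + κ g) ^ (-α)) (h₃ : ∀ g, ‖f₃ g‖ ≤ C₃ * (1 + κ g) ^ (-α)) :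
    Continuous (fun q : H₃ × H₃ =>
      kernelSum (fun γ : latticeIn E Γ e => (γ : H₃)) (descend (productFn f₁ f₂ f₃)) q.1 q.2) :=
  continuous_kernelSum_latticeIn E htc Γ P hΓ e (descend (productFn f₁ f₂ f₃))
    (continuous_descend _ hinv (continuous_productFn hc₁ hc₂ hc₃)) hc₁
    (fun g => descend_cover _ hinv g) hα h₂ h₃

end

end Summit.Ventures.HodgeRepro2.Tier7.Line3.ArchimedeanDescent
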